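import Summits.CriticalPhenomena.PercolationContinuityZ3.Theorems.PercNearOneGluingNoHeavyLowerTailMajorityGluingZFourteenEightP49
import Summits.CriticalPhenomena.PercolationContinuityZ3.Theorems.PercNearOneGluingNoHeavyLowerTailMajorityGluingZFourteenEightP50
import Summits.CriticalPhenomena.PercolationContinuityZ3.Theorems.PercNearOneGluingNoHeavyLowerTailMajorityGluingZFourteenEightP51
import Summits.CriticalPhenomena.PercolationContinuityZ3.Theorems.PercNearOneGluingNoHeavyLowerTailMajorityGluingZFourteenEightP52
import Summits.CriticalPhenomena.PercolationContinuityZ3.Theorems.PercNearOneGluingNoHeavyLowerTailMajorityGluingZFourteenEightP53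
import Summits.CriticalPhenomena.PercolationContinuityZ3.Theorems.PercNearOneGluingNoHeavyLowerTailMajorityGluingZFourteenEightP54
import Summits.CriticalPhenomena.PercolationContinuityZ3.Theorems.PercNearOneGluingNoHeavyLowerTailMajorityGluingZFourteenEightP55
import Summits.CriticalPhenomena.PercolationContinuityZ3.Theorems.PercNearOneGluingNoHeavyLowerTailMajorityGluingZFourteenEightP56
import Summits.CriticalPhenomena.PercolationContinuityZ3.Theorems.PercNearOneGluingNoHeavyLowerTailMajorityGluingZFourteenEightP57
import Summits.CriticalPhenomena.PercolationContinuityZ3.Theorems.PercNearOneGluingNoHeavyLowerTailMajorityGluingZFourteenEightP58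
import Summits.CriticalPhenomena.PercolationContinuityZ3.Theorems.PercNearOneGluingNoHeavyLowerTailMajorityGluingZFourteenEightP59
import Summits.CriticalPhenomena.PercolationContinuityZ3.Theorems.PercNearOneGluingNoHeavyLowerTailMajorityGluingZFourteenEightP60
import Summits.CriticalPhenomena.PercolationContinuityZ3.Theorems.PercNearOneGluingNoHeavyLowerTailMajorityGluingZFourteenEightHG5C1
import Summits.CriticalPhenomena.PercolationContinuityZ3.Theorems.PercNearOneGluingNoHeavyLowerTailMajorityGluingZFourteenEightHG5C2
import Summits.CriticalPhenomena.PercolationContinuityZ3.Theorems.PercNearOneGluingNoHeavyLowerTailMajorityGluingZFourteenEightHG5C3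
import Summits.CriticalPhenomena.PercolationContinuityZ3.Theorems.PercNearOneGluingNoHeavyLowerTailMajorityGluingZFourteenEightHG5C4
import Summits.CriticalPhenomena.PercolationContinuityZ3.Theorems.PercNearOneGluingNoHeavyLowerTailMajorityGluingZFourteenEightHG5C5
import Summits.CriticalPhenomena.PercolationContinuityZ3.Theorems.PercNearOneGluingNoHeavyLowerTailMajorityGluingZFourteenEightHG5C6
import Summits.CriticalPhenomena.PercolationContinuityZ3.Theorems.PercNearOneGluingNoHeavyLowerTailMajorityGluingZRangeAM
import HarnessLib

/-!
# Group 5 of 7 of the `(14,8)` certificate at `c = 3/2`: its aggregate-merge tree IS the concatenation of its 6 key-range chunks (lane prim-rate, constants-miner 1, gen 39; cert/mkhier.py)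

Support file for the closed crux `NoHeavyLowerTail` (stmt-CriticalPhenomena-4575), majority-gluing line.  The 12 parts P49, P50, P51, P52, P53, P54, P55, P56, P57, P58, P59, P60 (kit j310356) carry verified
type-space digests `…D`; `fourteenEightT2G5T` is their binary tree of aggregated merges (`am`, …MajorityGluingZRangeAM, depth 4); the kernel verifies `fourteenEightT2G5T = [chunks].flatten`
(`fourteenEightT2G5_eq`), and `fourteenEightT2G5_val` identifies the value of the group's digests with the value of its chunks (`evalC_am`).  No sorries. [cite: VandenbergKahn2001, Thm 1.2 (p. 123)]
-/

namespace Summit.CriticalPhenomena.PercolationContinuityZ3.Theorems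

namespace HubOnly
namespace QCert

/-- The aggregate-merge tree of group 5. -/
def fourteenEightT2G5T : List (ℕ × ℤ) :=
  am (am (am (am (fourteenEightTP49D) (fourteenEightTP50D)) (am (fourteenEightTP51D) (fourteenEightTP52D))) (am (am (fourteenEightTP53D) (fourteenEightTP54D)) (am (fourteenEightTP55D) (fourteenEightTP56D)))) (am (am (fourteenEightTP57D) (fourteenEightTP58D)) (am (fourteenEightTP59D) (fourteenEightTP60D)))

set_option maxRecDepth 8192 in
set_option maxHeartbeats 0 in
/-- **The tree of group 5 equals the concatenation of its key-range chunks** (kernel evaluation). -/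
theorem fourteenEightT2G5_eq : fourteenEightT2G5T = [fourteenEightT2G5C1, fourteenEightT2G5C2, fourteenEightT2G5C3, fourteenEightT2G5C4, fourteenEightT2G5C5, fourteenEightT2G5C6].flatten := by
  decide +kernel

/-- The tree's value is the value of the group's digests. -/
theorem fourteenEightT2G5_treeVal (val : ℕ → ℝ) : evalC val fourteenEightT2G5T = evalC val [fourteenEightTP49D, fourteenEightTP50D, fourteenEightTP51D, fourteenEightTP52D, fourteenEightTP53D, fourteenEightTP54D, fourteenEightTP55D, fourteenEightTP56D, fourteenEightTP57D, fourteenEightTP58D, fourteenEightTP59D, fourteenEightTP60D].flatten := by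
  simp only [fourteenEightT2G5T, evalC_am, List.flatten_cons, List.flatten_nil, evalC_append, evalC_nil', add_assoc, add_zero]

/-- **The value of group 5's digests is the value of its chunks.** -/
theorem fourteenEightT2G5_val (val : ℕ → ℝ) : evalC val [fourteenEightTP49D, fourteenEightTP50D, fourteenEightTP51D, fourteenEightTP52D, fourteenEightTP53D, fourteenEightTP54D, fourteenEightTP55D, fourteenEightTP56D, fourteenEightTP57D, fourteenEightTP58D, fourteenEightTP59D, fourteenEightTP60D].flatten = evalC val [fourteenEightT2G5C1, fourteenEightT2G5C2, fourteenEightT2G5C3, fourteenEightT2G5C4, fourteenEightT2G5C5, fourteenEightT2G5C6].flatten := by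
  rw [← fourteenEightT2G5_treeVal val, fourteenEightT2G5_eq]

end QCert
end HubOnly

end Summit.CriticalPhenomena.PercolationContinuityZ3.Theorems
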